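import Mathlib.RingTheory.HopfAlgebra.Quotient
import Mathlib.RingTheory.Artinian.Ring
import Mathlib.RingTheory.Localization.AtPrime.Basic
import Literature.RingTheory.PrincipalIdealRing.MonogenicLocalAlgebraIdeals
import Literature.RingTheory.Localization.CotangentAtMaximalIdeal
import HarnessLib

/-!
# Local quotients supported at a maximal ideal factor through the localisation; hence, at a point with
# one-dimensional Zariski tangent space, there is at most one local quotient (connected closed subscheme through the
# point — e.g. connected closed subgroup scheme) of each rank

Topic `Literature/RingTheory/Localization`; namespace `Literature.RingTheory.Localization`.  PROOF FILE (theorems only: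
no definition, no instance, no notation, no named fact, no `sorry`; imports Mathlib + ★ `PrincipalIdealRing.
MonogenicLocalAlgebraIdeals` (Atiyah–Macdonald 8.8: «at most one ideal of each colength» in an Artin local ring with
`dim 𝔪/𝔪² ≤ 1`) + ★ `Localization.CotangentAtMaximalIdeal` (`cotangentLocalizationEquiv`: `𝔫/𝔫² ≅ 𝔪_{B_𝔫}/𝔪_{B_𝔫}²`)
+ HarnessLib).  Cell `hodgecm-mathlib` (D-0151), FLOOR 0, programme
F0P5a (crux item stmt-HodgeConjecture-24832), generic capital for MOD-ROAD-P″ add2 §B3 [h2]/[h4]/(V): ★ G5 gives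
«at most one ideal of each colength» for a LOCAL coordinate ring; the consumer's ambient group `E[𝔴] ⊗ κ̄` is NOT
connected at an ordinary point, and «connected order-`q` subgroups of a 1-dimensional group are unique» needs the
reduction proved here: a LOCAL quotient `B ⧸ I` supported at the maximal ideal `𝔫` is a quotient of `B_𝔫`, of the
same `K`-dimension, and `I` is recovered from `I B_𝔫`.

RESULTS (`B` a commutative ring, `𝔫 ⊂ B` a maximal ideal, `S` any localisation of `B` at `𝔫`
(`[IsLocalization.AtPrime S 𝔫]`), `I ≤ 𝔫` an ideal with `B ⧸ I` LOCAL).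
* §1 `comap_maximalIdeal_quotient_eq` — the maximal ideal of `B ⧸ I` pulls back to `𝔫`; `isUnit_mk_of_not_mem` —
  elements off `𝔫` become units in `B ⧸ I`; **`comap_map_eq_of_isLocalRing_quotient`** — `(I S) ∩ B = I` (`I` is
  `𝔫`-saturated); `quotientMap_localization_bijective` — the induced map `B ⧸ I → S ⧸ I S` is a ring ISOMORPHISM;
  `finrank_localization_quotient_map_eq` — over a field `K`, `dim_K (S ⧸ I S) = dim_K (B ⧸ I)`.
  [Atiyah–Macdonald Prop. 3.11 (ii)/(iv) and Prop. 4.8 (`𝔫`-primary ideals are contracted from `B_𝔫`).]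
* §2 `algebraMap_residueField_surjective`, **`finrank_residueField_cotangentSpace_eq`** — at a `K`-RATIONAL point
  (`K → B ⧸ 𝔫` onto) the residue field of `B_𝔫` is `K` and `dim_{κ(B_𝔫)} 𝔪/𝔪² = dim_K 𝔫/𝔫²` (★
  `cotangentLocalizationEquiv`, Görtz–Wedhorn (6.3.1)); `finrank_quotient_cotangent_eq_finrank_residueField_
  cotangentSpace` — at ANY closed point `dim_{B/𝔫} 𝔫/𝔫² = dim_{κ(B_𝔫)} 𝔪/𝔪²` (semilinear over `B/𝔫 ≅ κ(B_𝔫)`).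
* §3 **`eq_of_isLocalRing_quotient_of_finrank_eq`** — for `B` finite-dimensional over a field `K` and `𝔫` maximal
  with `dim 𝔪/𝔪² ≤ 1` for `B_𝔫`: two ideals `I, J ≤ 𝔫` with local quotients of the same `K`-dimension are EQUAL, and
  any two such ideals are comparable (`le_or_le_of_isLocalRing_quotient`) — ★ A–M 8.8 on the Artin local ring
  `B_𝔫`; residue-field forms `…_of_finrank_quotient_cotangent_le_one` (hypothesis `dim_{B/𝔫} 𝔫/𝔫² ≤ 1`, any
  closed point) and rational-point forms `…_of_finrank_cotangent_le_one` (hypothesis `dim_K 𝔫/𝔫² ≤ 1`).  Scheme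
  reading: at a point `x ∈ X = Spec B` (finite over `K`) with `dim T_x X ≤ 1` there is at most one CONNECTED closed
  subscheme supported at `x` of each rank, and they form a chain.
* §4 **`hopfIdeal_eq_of_isLocalRing_quotient_of_finrank_eq`** — for a finite-dimensional commutative Hopf algebra
  over `K` whose augmentation ideal `ker ε` has `dim (ker ε)/(ker ε)² ≤ 1` («`dim Tgt_e(G) ≤ 1`», e.g. `G ⊂ A[𝔴]` for a
  one-dimensional formal `𝒪_w`-module): two Hopf ideals with LOCAL quotients («connected closed subgroup schemes»)
  of the same `K`-codimension («order») coincide, and all such are nested — [Milne2017] 2.15 / 11.30-style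
  uniqueness of the connected subgroup of given order inside a group with one-dimensional tangent space; Hopf
  ideals lie in `ker ε` by the coideal axiom (Mathlib `Ideal.IsHopfIdeal`).

HC_CM is proved only modulo the 7 printed citations until rung 0 closes; generic commutative algebra, changes no count.

## References
* [AtiyahMacdonald1969] M. F. Atiyah, I. G. Macdonald, *Introduction to Commutative Algebra* (1969): Prop. 3.11
  (extended and contracted ideals under localisation), Prop. 4.8 (contraction of `𝔫`-primary ideals from `B_𝔫`)
  («an ideal with local quotient at `𝔫` is contracted from `B_𝔫`»); Thm. 8.7; Prop. 8.8 and Example (Artin local, `𝔪` principal).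
* [GortzWedhorn2020] U. Görtz, T. Wedhorn, *Algebraic Geometry I*, 2nd ed., §6.3 (6.3.1), Remark 6.4 (`𝔪_x/𝔪_x² = 𝔪/𝔪²`).
* [Milne2017] J. S. Milne, *Algebraic Groups*, CUP 2017 (held `book:milnend-algebraic-groups`): 2.15 (finite étale
  ⇔ `Tgt_e = 0`; infinitesimal groups, p0127), Prop. 1.37 (p0104).
-/

set_option autoImplicit false

namespace Literature.RingTheory.Localization

open IsLocalRing

universe u v w

/-! ### §1 A local quotient supported at `𝔫` is a quotient of `B_𝔫` -/

section LocalQuotient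

variable {B : Type u} [CommRing B] (𝔫 : Ideal B) [h𝔫 : 𝔫.IsMaximal] (I : Ideal B) (hI : I ≤ 𝔫) [IsLocalRing (B ⧸ I)]

include hI in
/-- If `I ≤ 𝔫` with `𝔫` maximal and `B ⧸ I` is local, then **the maximal ideal of `B ⧸ I` pulls back to `𝔫`** (it pulls
back to a maximal ideal, and `𝔫`'s image is a proper ideal of the local ring `B ⧸ I`).
[cite: AtiyahMacdonald1969, Ch. 1 Prop. 1.1 and Ch. 3 Prop. 3.11 (iv)] -/
theorem comap_maximalIdeal_quotient_eq : (maximalIdeal (B ⧸ I)).comap (Ideal.Quotient.mk I) = 𝔫 := by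
  haveI : ((maximalIdeal (B ⧸ I)).comap (Ideal.Quotient.mk I)).IsMaximal :=
    Ideal.comap_isMaximal_of_surjective _ Ideal.Quotient.mk_surjective
  have hne : 𝔫.map (Ideal.Quotient.mk I) ≠ ⊤ := by
    intro htop
    rw [Ideal.eq_top_iff_one] at htop
    have h1 : (1 : B ⧸ I) ∈ (𝔫.map (Ideal.Quotient.mk I)) := htop
    rw [Ideal.mem_map_iff_of_surjective _ Ideal.Quotient.mk_surjective] at h1
    obtain ⟨n, hn, hn1⟩ := h1
    have hsub : n - 1 ∈ I := by
      rw [← Ideal.Quotient.eq, hn1, map_one]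
    have : (1 : B) ∈ 𝔫 := by
      have h' : n - (n - 1) ∈ 𝔫 := 𝔫.sub_mem hn (hI hsub)
      rwa [sub_sub_cancel] at h'
    exact h𝔫.ne_top ((Ideal.eq_top_iff_one 𝔫).mpr this)
  have hle : 𝔫 ≤ (maximalIdeal (B ⧸ I)).comap (Ideal.Quotient.mk I) := by
    rw [← Ideal.map_le_iff_le_comap]
    exact IsLocalRing.le_maximalIdeal hne
  exact (h𝔫.eq_of_le (Ideal.IsMaximal.ne_top inferInstance) hle).symm

include hI in
/-- If `I ≤ 𝔫` with `𝔫` maximal and `B ⧸ I` local, then **every element off `𝔫` is a unit modulo `I`**.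
[cite: AtiyahMacdonald1969, Ch. 3 Prop. 3.11 (iv) and Ch. 4 Prop. 4.8] -/
theorem isUnit_mk_of_not_mem {s : B} (hs : s ∉ 𝔫) : IsUnit (Ideal.Quotient.mk I s) := by
  by_contra hu
  have hmem : Ideal.Quotient.mk I s ∈ maximalIdeal (B ⧸ I) := (IsLocalRing.mem_maximalIdeal _).mpr hu
  have : s ∈ (maximalIdeal (B ⧸ I)).comap (Ideal.Quotient.mk I) := hmem
  rw [comap_maximalIdeal_quotient_eq 𝔫 I hI] at this
  exact hs this

variable (S : Type v) [CommRing S] [Algebra B S] [IsLocalization.AtPrime S 𝔫]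

include hI in
/-- **A local quotient supported at `𝔫` is contracted from `B_𝔫`: `(I·B_𝔫) ∩ B = I`.**  If `x/1 ∈ I B_𝔫` then
`c m x ∈ I` for some `c, m ∉ 𝔫`, and `c m` is a unit modulo `I`. (For `I` `𝔫`-primary this is Atiyah–Macdonald 4.8.)
[cite: AtiyahMacdonald1969, Ch. 3 Prop. 3.11 (ii),(iv) and Ch. 4 Prop. 4.8 (ii)] -/
theorem comap_map_eq_of_isLocalRing_quotient : (I.map (algebraMap B S)).comap (algebraMap B S) = I := by
  refine le_antisymm (fun x hx => ?_) Ideal.le_comap_map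
  rw [Ideal.mem_comap, IsLocalization.mem_map_algebraMap_iff 𝔫.primeCompl S] at hx
  obtain ⟨⟨⟨a, ha⟩, ⟨m, hm⟩⟩, hx⟩ := hx
  -- `x m / 1 = a / 1` in `S`, so `c (x m - a) = 0` for some `c ∉ 𝔫`
  have h0 : algebraMap B S (x * m - a) = 0 := by
    rw [map_sub, map_mul, sub_eq_zero]
    exact hx
  obtain ⟨⟨c, hc⟩, hc0⟩ := (IsLocalization.map_eq_zero_iff 𝔫.primeCompl S _).mp h0
  have hcI : c * m * x - c * a ∈ I := by
    have : c * (x * m - a) = c * m * x - c * a := by ring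
    rw [← this, hc0]
    exact I.zero_mem
  have hcmx : c * m * x ∈ I := by
    have h' := I.add_mem hcI (I.mul_mem_left c ha)
    rwa [sub_add_cancel] at h'
  -- `c m ∉ 𝔫` is a unit mod `I`
  have hcm : c * m ∉ 𝔫 := fun h => (h𝔫.isPrime.mem_or_mem h).elim hc hm
  obtain ⟨u, hu⟩ := isUnit_mk_of_not_mem 𝔫 I hI hcm
  rw [← Ideal.Quotient.eq_zero_iff_mem] at hcmx ⊢
  rw [map_mul, ← hu] at hcmx
  exact (Units.mul_right_eq_zero u).mp hcmx

include hI in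
/-- **`B ⧸ I ≅ B_𝔫 ⧸ I B_𝔫` for a local quotient supported at `𝔫`:** the induced ring map `B ⧸ I → S ⧸ I S` is
bijective (injective by `comap_map_eq_of_isLocalRing_quotient`; surjective because denominators off `𝔫` are already
invertible in `B ⧸ I`).  The case `I = 𝔫` is Mathlib's `IsLocalization.AtPrime.equivQuotMaximalIdeal`.
[cite: AtiyahMacdonald1969, Ch. 3 Prop. 3.11 and Ch. 4 Prop. 4.8] -/
theorem quotientMap_localization_bijective :
    Function.Bijective (Ideal.quotientMap (I.map (algebraMap B S)) (algebraMap B S) Ideal.le_comap_map) := by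
  set q := Ideal.quotientMap (I.map (algebraMap B S)) (algebraMap B S) Ideal.le_comap_map with hq
  refine ⟨?_, ?_⟩
  · rw [injective_iff_map_eq_zero]
    intro y hy
    obtain ⟨x, rfl⟩ := Ideal.Quotient.mk_surjective y
    rw [Ideal.quotientMap_mk, Ideal.Quotient.eq_zero_iff_mem, ← Ideal.mem_comap,
      comap_map_eq_of_isLocalRing_quotient 𝔫 I hI S] at hy
    exact Ideal.Quotient.eq_zero_iff_mem.mpr hy
  · intro z
    obtain ⟨z, rfl⟩ := Ideal.Quotient.mk_surjective z
    obtain ⟨⟨a, s⟩, rfl⟩ := IsLocalization.mk'_surjective 𝔫.primeCompl z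
    obtain ⟨u, hu⟩ := isUnit_mk_of_not_mem 𝔫 I hI (s := (s : B)) s.2
    refine ⟨Ideal.Quotient.mk I a * ↑u⁻¹, ?_⟩
    -- both sides agree after multiplying by the unit image of `s`
    have hs_unit : IsUnit (q (Ideal.Quotient.mk I s)) := by rw [← hu]; exact (u.map q.toMonoidHom).isUnit
    refine (hs_unit.mul_left_inj).mp ?_
    rw [map_mul, mul_assoc, ← hu, ← map_mul, Units.inv_mul, map_one, mul_one, hu, hq,
      Ideal.quotientMap_mk, Ideal.quotientMap_mk, ← map_mul, IsLocalization.mk'_spec]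

end LocalQuotient

/-! ### §1 (cont.) The `K`-dimension of a local quotient equals that of its localised form -/

section Finrank

variable (K : Type w) [Field K] {B : Type u} [CommRing B] [Algebra K B] (𝔫 : Ideal B) [h𝔫 : 𝔫.IsMaximal]
  (S : Type v) [CommRing S] [Algebra B S] [Algebra K S] [IsScalarTower K B S] [IsLocalization.AtPrime S 𝔫]

/-- **`dim_K (B_𝔫 ⧸ I B_𝔫) = dim_K (B ⧸ I)`** for a local quotient supported at `𝔫` (the ring isomorphism
`quotientMap_localization_bijective` is `K`-linear). [cite: AtiyahMacdonald1969, Ch. 3 Prop. 3.11 and Ch. 4 Prop. 4.8] -/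
theorem finrank_localization_quotient_map_eq (I : Ideal B) (hI : I ≤ 𝔫) [IsLocalRing (B ⧸ I)] :
    Module.finrank K (S ⧸ I.map (algebraMap B S)) = Module.finrank K (B ⧸ I) := by
  have hle : I ≤ (I.map (algebraMap B S)).comap (IsScalarTower.toAlgHom K B S) := Ideal.le_comap_map
  let q : (B ⧸ I) →ₐ[K] (S ⧸ I.map (algebraMap B S)) :=
    Ideal.quotientMapₐ (I.map (algebraMap B S)) (IsScalarTower.toAlgHom K B S) hle
  have hq : Function.Bijective q := quotientMap_localization_bijective 𝔫 I hI S
  exact (LinearEquiv.ofBijective q.toLinearMap hq).finrank_eq.symm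

/-! ### §2 The cotangent space `𝔫/𝔫²` versus that of `B_𝔫`, at a `K`-rational point -/

section Rational

variable [IsLocalRing S]

/-- The `K`-action on the cotangent space of the local `K`-algebra `S` factors through its residue field (plumbing).
[folklore] -/
private theorem isScalarTower_residueField_cotangentSpace : IsScalarTower K (ResidueField S) (CotangentSpace S) :=
  IsScalarTower.of_algebraMap_smul fun r x => by
    rw [IsScalarTower.algebraMap_apply K S (ResidueField S), IsScalarTower.algebraMap_smul,
      IsScalarTower.algebraMap_smul]

/-- **At a `K`-rational point the residue field of `B_𝔫` is `K`**: if `K → B ⧸ 𝔫` is onto then so is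
`K → κ(B_𝔫)` (`B ⧸ 𝔫 ≅ κ(B_𝔫)`, Mathlib `IsLocalization.AtPrime.equivQuotMaximalIdeal`).
[cite: AtiyahMacdonald1969, Ch. 3 Prop. 3.11 and Ch. 4 Prop. 4.8] -/
theorem algebraMap_residueField_surjective (hK : Function.Surjective (algebraMap K (B ⧸ 𝔫))) :
    Function.Surjective (algebraMap K (ResidueField S)) := by
  intro z
  obtain ⟨y, rfl⟩ := (IsLocalization.AtPrime.equivQuotMaximalIdeal 𝔫 S).surjective z
  obtain ⟨r, rfl⟩ := hK y
  refine ⟨r, ?_⟩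
  rw [← Ideal.Quotient.mk_algebraMap, IsLocalization.AtPrime.equivQuotMaximalIdeal_apply_mk,
    ← IsScalarTower.algebraMap_apply K B S, Ideal.Quotient.mk_algebraMap]
  rfl

/-- **`dim_{κ(B_𝔫)} 𝔪/𝔪² = dim_K 𝔫/𝔫²` at a `K`-rational point** (`𝔪` the maximal ideal of `B_𝔫`): `𝔫/𝔫² ≅ 𝔪/𝔪²`
(★ `cotangentLocalizationEquiv`, Görtz–Wedhorn (6.3.1)) and `κ(B_𝔫) = K`.  This converts the consumer's hypothesis
«`dim_K Tgt_x ≤ 1`» into the Artin-local-ring hypothesis of ★ Atiyah–Macdonald 8.8. [cite: AtiyahMacdonald1969,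
Ch. 8 Prop. 8.8 (iii); Ch. 3 Prop. 3.11] -/
theorem finrank_residueField_cotangentSpace_eq (hK : Function.Surjective (algebraMap K (B ⧸ 𝔫))) :
    Module.finrank (ResidueField S) (CotangentSpace S) = Module.finrank K 𝔫.Cotangent := by
  haveI := isScalarTower_residueField_cotangentSpace K S
  have hbij : Function.Bijective (algebraMap K (ResidueField S)) :=
    ⟨(algebraMap K (ResidueField S)).injective, algebraMap_residueField_surjective K 𝔫 S hK⟩
  have h1 : Module.finrank K (ResidueField S) = 1 := by
    rw [← (LinearEquiv.ofBijective (Algebra.linearMap K (ResidueField S)) hbij).finrank_eq, Module.finrank_self]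
  have h2 : Module.finrank K (CotangentSpace S) = Module.finrank K 𝔫.Cotangent :=
    ((cotangentLocalizationEquiv 𝔫 S).restrictScalars K).finrank_eq.symm
  rw [← h2, ← Module.finrank_mul_finrank K (ResidueField S) (CotangentSpace S), h1, one_mul]

/-- **`dim_{B/𝔫} 𝔫/𝔫² = dim_{κ(B_𝔫)} 𝔪/𝔪²`** (any maximal `𝔫`, no rationality): the `B`-linear bijection
`𝔫/𝔫² ≅ 𝔪/𝔪²` (★ `cotangentLocalizationEquiv`, Görtz–Wedhorn (6.3.1)) is semilinear over the field isomorphism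
`B ⧸ 𝔫 ≅ κ(B_𝔫)` (Mathlib `IsLocalization.AtPrime.equivQuotMaximalIdeal`).  (Same statement as the tree's
`NumberRing.finrank_cotangent_eq_finrank_cotangentSpace`, re-derived here over the `Localization/` organ to keep this
file's import closure inside `RingTheory`.) [cite: AtiyahMacdonald1969, Ch. 3 Prop. 3.11; Ch. 8 Prop. 8.8 (iii)]
[cite: GortzWedhorn2020, §6.3 (6.3.1) and Remark 6.4] -/
theorem finrank_quotient_cotangent_eq_finrank_residueField_cotangentSpace :
    Module.finrank (B ⧸ 𝔫) 𝔫.Cotangent = Module.finrank (ResidueField S) (CotangentSpace S) := by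
  set j : 𝔫.Cotangent ≃+ CotangentSpace S := (cotangentLocalizationEquiv 𝔫 S).toAddEquiv with hj
  have h := lift_rank_eq_of_equiv_equiv (R := B ⧸ 𝔫) (R' := ResidueField S) (M := 𝔫.Cotangent)
    (M' := CotangentSpace S) (IsLocalization.AtPrime.equivQuotMaximalIdeal 𝔫 S) j
    (IsLocalization.AtPrime.equivQuotMaximalIdeal 𝔫 S).bijective (fun r m ↦ by
      obtain ⟨a, rfl⟩ := Ideal.Quotient.mk_surjective r
      rw [IsLocalization.AtPrime.equivQuotMaximalIdeal_apply_mk, ← Ideal.Quotient.algebraMap_eq, algebraMap_smul]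
      change cotangentLocalizationEquiv 𝔫 S (a • m) =
        (IsLocalRing.residue S (algebraMap B S a)) • cotangentLocalizationEquiv 𝔫 S m
      rw [map_smul, ← IsLocalRing.ResidueField.algebraMap_eq, algebraMap_smul, algebraMap_smul])
  simpa [Module.finrank] using congr_arg Cardinal.toNat h

end Rational

/-! ### §3 At most one local quotient of each rank at a point with `dim 𝔪_x/𝔪_x² ≤ 1` -/

variable [Module.Finite K B]

include 𝔫 in
/-- The localisation of a finite-dimensional algebra at a maximal ideal is finite-dimensional (an Artin ring maps ONTO
each of its localisations, Mathlib `IsArtinianRing.localization_surjective`). [cite: AtiyahMacdonald1969, Ch. 8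
Thm. 8.7 (Artin ring `= Π` local Artin rings)] -/
theorem finite_localization_atPrime : Module.Finite K S := by
  haveI : IsArtinianRing B := IsArtinianRing.of_finite K B
  exact Module.Finite.of_surjective (IsScalarTower.toAlgHom K B S).toLinearMap
    (IsArtinianRing.localization_surjective 𝔫.primeCompl S)

include K in
/-- **Local quotients supported at a point of embedding dimension `≤ 1` are NESTED**: for `B` finite-dimensional over
`K`, `𝔫` maximal with `dim 𝔪/𝔪² ≤ 1` for the local ring `B_𝔫`, any two ideals `I, J ≤ 𝔫` with `B ⧸ I`, `B ⧸ J` local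
are comparable — their extensions to the Artin local ring `B_𝔫` are powers of its principal maximal ideal
(Atiyah–Macdonald 8.8), and both are contracted from `B_𝔫`. [cite: AtiyahMacdonald1969, Ch. 8 Prop. 8.8 and
Example; Ch. 4 Prop. 4.8] -/
theorem le_or_le_of_isLocalRing_quotient
    (h1 : Module.finrank (ResidueField (Localization.AtPrime 𝔫)) (CotangentSpace (Localization.AtPrime 𝔫)) ≤ 1)
    (I J : Ideal B) (hI : I ≤ 𝔫) (hJ : J ≤ 𝔫) [IsLocalRing (B ⧸ I)] [IsLocalRing (B ⧸ J)] : I ≤ J ∨ J ≤ I := by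
  let S' := Localization.AtPrime 𝔫
  haveI : Module.Finite K S' := finite_localization_atPrime K 𝔫 S'
  haveI : IsArtinianRing S' := IsArtinianRing.of_finite K S'
  rcases Literature.RingTheory.PrincipalIdealRing.le_total_of_finrank_cotangentSpace_le_one h1
      (I.map (algebraMap B S')) (J.map (algebraMap B S')) with hle | hle
  · left
    rw [← comap_map_eq_of_isLocalRing_quotient 𝔫 I hI S', ← comap_map_eq_of_isLocalRing_quotient 𝔫 J hJ S']
    exact Ideal.comap_mono hle
  · right
    rw [← comap_map_eq_of_isLocalRing_quotient 𝔫 I hI S', ← comap_map_eq_of_isLocalRing_quotient 𝔫 J hJ S']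
    exact Ideal.comap_mono hle

/-- **At most one local quotient of each rank at a point of embedding dimension `≤ 1`**: for `B`
finite-dimensional over a field `K`, `𝔫` maximal with `dim 𝔪/𝔪² ≤ 1` for the local ring `B_𝔫`, two ideals
`I, J ≤ 𝔫` with `B ⧸ I`, `B ⧸ J` LOCAL and `dim_K (B ⧸ I) = dim_K (B ⧸ J)` are EQUAL.  (Pass to the Artin local ring
`B_𝔫`, where «at most one ideal of each colength» is Atiyah–Macdonald 8.8 — ★
`eq_of_finrank_quotient_eq_of_finrank_cotangentSpace_le_one` —, and contract back with
`comap_map_eq_of_isLocalRing_quotient`.)  Scheme reading: a connected closed subscheme of `Spec B` supported at a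
point `x` with `dim T_x ≤ 1` is determined by its rank. [cite: AtiyahMacdonald1969, Ch. 8 Prop. 8.8 and Example;
Ch. 4 Prop. 4.8] -/
theorem eq_of_isLocalRing_quotient_of_finrank_eq
    (h1 : Module.finrank (ResidueField (Localization.AtPrime 𝔫)) (CotangentSpace (Localization.AtPrime 𝔫)) ≤ 1)
    {I J : Ideal B} (hI : I ≤ 𝔫) (hJ : J ≤ 𝔫) [IsLocalRing (B ⧸ I)] [IsLocalRing (B ⧸ J)]
    (h : Module.finrank K (B ⧸ I) = Module.finrank K (B ⧸ J)) : I = J := by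
  let S' := Localization.AtPrime 𝔫
  haveI : Module.Finite K S' := finite_localization_atPrime K 𝔫 S'
  have h' : Module.finrank K (S' ⧸ I.map (algebraMap B S')) = Module.finrank K (S' ⧸ J.map (algebraMap B S')) := by
    rw [finrank_localization_quotient_map_eq K 𝔫 S' I hI, finrank_localization_quotient_map_eq K 𝔫 S' J hJ, h]
  have hIJ : I.map (algebraMap B S') = J.map (algebraMap B S') :=
    Literature.RingTheory.PrincipalIdealRing.eq_of_finrank_quotient_eq_of_finrank_cotangentSpace_le_one h1 h'
  rw [← comap_map_eq_of_isLocalRing_quotient 𝔫 I hI S', ← comap_map_eq_of_isLocalRing_quotient 𝔫 J hJ S', hIJ]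

/-- **Rational-point form**: for `B` finite-dimensional over `K` and a maximal ideal `𝔫` with `B ⧸ 𝔫 = K`
(`K → B ⧸ 𝔫` onto) and `dim_K 𝔫/𝔫² ≤ 1`, two ideals `I, J ≤ 𝔫` with local quotients of the same `K`-dimension are
equal. [cite: AtiyahMacdonald1969, Ch. 8 Prop. 8.8 and Example; Ch. 4 Prop. 4.8] -/
theorem eq_of_isLocalRing_quotient_of_finrank_cotangent_le_one (hK : Function.Surjective (algebraMap K (B ⧸ 𝔫)))
    (h1 : Module.finrank K 𝔫.Cotangent ≤ 1) {I J : Ideal B} (hI : I ≤ 𝔫) (hJ : J ≤ 𝔫) [IsLocalRing (B ⧸ I)]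
    [IsLocalRing (B ⧸ J)] (h : Module.finrank K (B ⧸ I) = Module.finrank K (B ⧸ J)) : I = J :=
  eq_of_isLocalRing_quotient_of_finrank_eq K 𝔫
    (by rw [finrank_residueField_cotangentSpace_eq K 𝔫 (Localization.AtPrime 𝔫) hK]; exact h1) hI hJ h

/-- **Rational-point form of the nesting**: with `B ⧸ 𝔫 = K` and `dim_K 𝔫/𝔫² ≤ 1`, ideals `I, J ≤ 𝔫` with local
quotients are comparable. [cite: AtiyahMacdonald1969, Ch. 8 Prop. 8.8 and Example; Ch. 4 Prop. 4.8] -/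
theorem le_or_le_of_isLocalRing_quotient_of_finrank_cotangent_le_one
    (hK : Function.Surjective (algebraMap K (B ⧸ 𝔫))) (h1 : Module.finrank K 𝔫.Cotangent ≤ 1) (I J : Ideal B)
    (hI : I ≤ 𝔫) (hJ : J ≤ 𝔫) [IsLocalRing (B ⧸ I)] [IsLocalRing (B ⧸ J)] : I ≤ J ∨ J ≤ I :=
  le_or_le_of_isLocalRing_quotient K 𝔫
    (by rw [finrank_residueField_cotangentSpace_eq K 𝔫 (Localization.AtPrime 𝔫) hK]; exact h1) I J hI hJ

/-- **Residue-field form** (any closed point): for `B` finite-dimensional over `K`, `𝔫` maximal with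
`dim_{B/𝔫} 𝔫/𝔫² ≤ 1`, two ideals `I, J ≤ 𝔫` with local quotients of the same `K`-dimension are equal.
[cite: AtiyahMacdonald1969, Ch. 8 Prop. 8.8 and Example; Ch. 4 Prop. 4.8] -/
theorem eq_of_isLocalRing_quotient_of_finrank_quotient_cotangent_le_one
    (h1 : Module.finrank (B ⧸ 𝔫) 𝔫.Cotangent ≤ 1) {I J : Ideal B} (hI : I ≤ 𝔫) (hJ : J ≤ 𝔫) [IsLocalRing (B ⧸ I)]
    [IsLocalRing (B ⧸ J)] (h : Module.finrank K (B ⧸ I) = Module.finrank K (B ⧸ J)) : I = J :=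
  eq_of_isLocalRing_quotient_of_finrank_eq K 𝔫
    (by rw [← finrank_quotient_cotangent_eq_finrank_residueField_cotangentSpace 𝔫 (Localization.AtPrime 𝔫)]
        exact h1) hI hJ h

include K in
/-- **Residue-field form of the nesting** (any closed point): with `dim_{B/𝔫} 𝔫/𝔫² ≤ 1`, ideals `I, J ≤ 𝔫` with
local quotients are comparable. [cite: AtiyahMacdonald1969, Ch. 8 Prop. 8.8 and Example; Ch. 4 Prop. 4.8] -/
theorem le_or_le_of_isLocalRing_quotient_of_finrank_quotient_cotangent_le_one
    (h1 : Module.finrank (B ⧸ 𝔫) 𝔫.Cotangent ≤ 1) (I J : Ideal B) (hI : I ≤ 𝔫) (hJ : J ≤ 𝔫) [IsLocalRing (B ⧸ I)]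
    [IsLocalRing (B ⧸ J)] : I ≤ J ∨ J ≤ I :=
  le_or_le_of_isLocalRing_quotient K 𝔫
    (by rw [← finrank_quotient_cotangent_eq_finrank_residueField_cotangentSpace 𝔫 (Localization.AtPrime 𝔫)]
        exact h1) I J hI hJ

end Finrank

/-! ### §4 Connected closed subgroup schemes of a finite commutative group scheme with `dim Tgt_e ≤ 1` -/

section Hopf

variable (K : Type w) [Field K] {B : Type u} [CommRing B] [HopfAlgebra K B]

/-- The augmentation ideal `ker ε` of a bialgebra over a field is maximal (`ε` is onto the field `K`).
[cite: Milne2017, §2.a (p0127)] -/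
theorem ker_counitAlgHom_isMaximal : (RingHom.ker (Bialgebra.counitAlgHom K B)).IsMaximal :=
  RingHom.ker_isMaximal_of_surjective (Bialgebra.counitAlgHom K B) fun r =>
    ⟨algebraMap K B r, by rw [Bialgebra.counitAlgHom_apply, Bialgebra.counit_algebraMap]⟩

/-- A Hopf ideal lies in the augmentation ideal (the counit vanishes on a coideal — Mathlib
`Submodule.IsCoideal.counit_eq_zero`): every closed subgroup scheme passes through `e`. [cite: Milne2017, §2.a
(p0127)] -/
theorem le_ker_counitAlgHom_of_isHopfIdeal (I : Ideal B) [hI : I.IsHopfIdeal K] :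
    I ≤ RingHom.ker (Bialgebra.counitAlgHom K B) := fun x hx => by
  rw [RingHom.mem_ker, Bialgebra.counitAlgHom_apply]
  exact Submodule.IsCoideal.counit_eq_zero (I := I.restrictScalars K) hx

/-- The origin is a `K`-rational point: `K → B ⧸ ker ε` is onto (`b ≡ ε(b) (mod ker ε)`).
[cite: Milne2017, §2.a (p0127)] -/
theorem algebraMap_quotient_ker_counitAlgHom_surjective :
    Function.Surjective (algebraMap K (B ⧸ RingHom.ker (Bialgebra.counitAlgHom K B))) := by
  intro y
  obtain ⟨b, rfl⟩ := Ideal.Quotient.mk_surjective y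
  refine ⟨Bialgebra.counitAlgHom K B b, ?_⟩
  rw [← Ideal.Quotient.mk_algebraMap, Ideal.Quotient.eq, RingHom.mem_ker, map_sub, AlgHom.commutes, sub_eq_zero,
    Algebra.algebraMap_self, RingHom.id_apply]

variable [Module.Finite K B]

/-- **A finite commutative group scheme with `dim Tgt_e(G) ≤ 1` has at most one CONNECTED closed subgroup scheme of
each order**: for a finite-dimensional commutative Hopf algebra `B` over a field `K` whose augmentation ideal
`𝔫 = ker ε` has `dim_K 𝔫/𝔫² ≤ 1`, two Hopf ideals `I`, `J` with `B ⧸ I`, `B ⧸ J` LOCAL and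
`dim_K (B ⧸ I) = dim_K (B ⧸ J)` coincide (`eq_of_isLocalRing_quotient_of_finrank_eq` at `𝔫 = ker ε`; Hopf ideals lie
in `ker ε` by the field `Submodule.IsCoideal.counit_eq_zero` of Mathlib's `Ideal.IsHopfIdeal K I :
(I.restrictScalars K).IsCoideal ∧ S(I) ⊆ I`, see `le_ker_counitAlgHom_of_isHopfIdeal`).  This is the uniqueness used for the order-`q` connected subgroup of a one-dimensional formal module's
torsion («a finite group scheme is étale iff `Tgt_e(G) = 0`»; here `dim Tgt_e ≤ 1`). [cite: Milne2017, 2.15 (p0127);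
AtiyahMacdonald1969, Ch. 8 Prop. 8.8] -/
theorem hopfIdeal_eq_of_isLocalRing_quotient_of_finrank_eq
    (h1 : Module.finrank K (RingHom.ker (Bialgebra.counitAlgHom K B)).Cotangent ≤ 1)
    (I J : Ideal B) [I.IsHopfIdeal K] [J.IsHopfIdeal K] [IsLocalRing (B ⧸ I)] [IsLocalRing (B ⧸ J)]
    (h : Module.finrank K (B ⧸ I) = Module.finrank K (B ⧸ J)) : I = J :=
  haveI := ker_counitAlgHom_isMaximal K (B := B)
  eq_of_isLocalRing_quotient_of_finrank_cotangent_le_one K (RingHom.ker (Bialgebra.counitAlgHom K B))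
    (algebraMap_quotient_ker_counitAlgHom_surjective K) h1
    (le_ker_counitAlgHom_of_isHopfIdeal K I) (le_ker_counitAlgHom_of_isHopfIdeal K J) h

/-- **Connected closed subgroup schemes of a finite commutative group scheme with `dim Tgt_e(G) ≤ 1` are NESTED**
(any two Hopf ideals with local quotients are comparable). [cite: Milne2017, 2.15 (p0127); AtiyahMacdonald1969, Ch. 8
Prop. 8.8 and Example] -/
theorem hopfIdeal_le_or_le_of_isLocalRing_quotient
    (h1 : Module.finrank K (RingHom.ker (Bialgebra.counitAlgHom K B)).Cotangent ≤ 1)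
    (I J : Ideal B) [I.IsHopfIdeal K] [J.IsHopfIdeal K] [IsLocalRing (B ⧸ I)] [IsLocalRing (B ⧸ J)] :
    I ≤ J ∨ J ≤ I :=
  haveI := ker_counitAlgHom_isMaximal K (B := B)
  le_or_le_of_isLocalRing_quotient_of_finrank_cotangent_le_one K (RingHom.ker (Bialgebra.counitAlgHom K B))
    (algebraMap_quotient_ker_counitAlgHom_surjective K) h1 I J
    (le_ker_counitAlgHom_of_isHopfIdeal K I) (le_ker_counitAlgHom_of_isHopfIdeal K J)

end Hopf

end Literature.RingTheory.Localization
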